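import Mathlib
import Summits.Ventures.PercRepro2.Defs
import Summits.Ventures.PercRepro2.Independence
import Summits.Ventures.PercRepro2.Harris
import Summits.Ventures.PercRepro2.Graph
import Summits.Ventures.PercRepro2.Exploration
import Summits.Ventures.PercRepro2.Events
import Summits.Ventures.PercRepro2.Induced
import Summits.Ventures.PercRepro2.BHK
import Summits.Ventures.PercRepro2.BHKEvents
import Summits.Ventures.PercRepro2.OneEdge
import Summits.Ventures.PercRepro2.RBRoot
import Summits.Ventures.PercRepro2.RBRootEdge
import Summits.Ventures.PercRepro2.RBRootEdgePin
import Summits.Ventures.PercRepro2.RBRootEdgeMain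
import Summits.Ventures.PercRepro2.RBRootIsolated

/-!
# Row 2′RB at a third vertex adjacent only to the two markers — same form, I (mine-a g5; MINE-A.md §32; the theorem is in `RBTwoMarkersMain.lean`)

Let the only edges at the third vertex `w` be `e₁ = {w, b}` and `e₂ = {w, o}`. Pinning the two
edges (the Rao–Blackwell sum is affine in each marker-edge weight, `rbSum_pin_same_marker`) gives
the four patterns: `e₂` open — the cluster of `w` is the cluster of the marker `o`, the sum
collapses to `P(Q ∩ bL ∩ oL)`; `e₂` closed, `e₁` open — it collapses at `b`; both closed — `w` is
isolated (`RBRoot.rbSum_isolated`). Forcing a single edge at a leaf changes no connection among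
the other vertices (`conn_leaf_iff`), so three of the four patterns see the graph `G − w`; under
the fourth both markers lie in `C(w)` and `bL = oL = {s ∈ C(w)}` almost surely. The cleared
inequality that remains (`mix_var`: with `x = p e₁ · p e₂`, `M = P₁₁(Q ∩ bL)`, `Z₁ = P₁₁(Q)`,
`A, C, Z` the `G − w` masses) is
`(xM + (1−x)A)(xM + (1−x)C)/(xZ₁ + (1−x)Z) ≤ xM + (1−x)·AC/Z`, whose cleared difference is
`x²MZ(Z₁ − M) + x(1−x)[M(Z−A)(Z−C) + (Z₁−M)AC] ≥ 0` — the variance of `1[s ∈ C(w)]` under the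
fourth pattern dominates the star term. With BHK 1.3 on `G − w` (`RBRoot.same_collapsed`) this is
`same_two_markers`. `LeafZero`: the weight-free leaf invariance (`prob_leaf_update_events`: every
other edge at `w` of weight `0`), the form the kernel theorem of `RBKernel.lean` needs. -/

namespace Summit.Ventures.PercRepro2
namespace RBTwoMarkers

open scoped Classical

section Leaf

variable {V : Type*} {E : Type*} [DecidableEq E] (ends : E → Sym2 V) (w : V)

omit [DecidableEq E] in
/-- If every edge at `w` is closed in `ω`, the cluster of `w` is `{w}`. -/
lemma cluster_eq_singleton_of_closed {ω : Config E} (hcl : ∀ e, w ∈ ends e → ω e = false) :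
    cluster ends ω w = {w} := by
  ext u
  simp only [mem_cluster, Set.mem_singleton_iff]
  constructor
  · intro hu
    have key : u ∈ ({w} : Set V) := by
      refine mem_of_conn_of_closed (ends := ends) (ω := ω) ?_ (Set.mem_singleton w) hu
      intro x hx y hxy
      rw [Set.mem_singleton_iff] at hx
      subst hx
      obtain ⟨_, e, he, hends⟩ := openGraph_adj.1 hxy
      have := hcl e (by rw [hends]; exact Sym2.mem_mk_left x y)
      rw [he] at this
      simp at this
    exact Set.mem_singleton_iff.1 key
  · rintro rfl
    exact conn_refl _ _ _

/-- **Leaf lemma, weight-free form**: if every edge at `w` other than `e₁ = {w, b}` is closed in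
`ω`, forcing `e₁` does not change the connections between vertices `≠ w`. -/
lemma conn_leaf_iff_of_closed {e₁ : E} {b : V} (hends : ends e₁ = s(w, b)) {ω : Config E}
    (hcl : ∀ e, w ∈ ends e ∧ e ≠ e₁ → ω e = false) {x y : V} (hx : x ≠ w) (hy : y ≠ w)
    (c : Bool) : Conn ends (Function.update ω e₁ c) x y ↔ Conn ends ω x y := by
  set ω₀ := Function.update ω e₁ false with hω₀
  have hcl₀ : ∀ e, w ∈ ends e → ω₀ e = false := by
    intro e he
    by_cases h : e = e₁
    · subst h; simp [hω₀]
    · rw [hω₀, Function.update_of_ne h]; exact hcl e ⟨he, h⟩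
  have hiso : ∀ z, Conn ends ω₀ z w ↔ z = w := by
    intro z
    constructor
    · intro h
      have hz : z ∈ cluster ends ω₀ w := conn_symm h
      rw [cluster_eq_singleton_of_closed ends w hcl₀] at hz
      exact hz
    · rintro rfl; exact conn_refl _ _ _
  have key : ∀ c' : Bool, Conn ends (Function.update ω₀ e₁ c') x y ↔ Conn ends ω₀ x y := by
    intro c'
    cases c'
    · rw [hω₀, Function.update_idem]
    · rw [OneEdge.conn_update_true_iff hends]
      constructor
      · rintro (h | ⟨h, _⟩ | ⟨_, h⟩)
        · exact h
        · exact absurd ((hiso x).1 h) hx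
        · exact absurd ((hiso y).1 (conn_symm h)) hy
      · exact fun h => Or.inl h
  have e1 : Function.update ω e₁ c = Function.update ω₀ e₁ c := by
    rw [hω₀, Function.update_idem]
  have e2 : ω = Function.update ω₀ e₁ (ω e₁) := by
    rw [hω₀, Function.update_idem, Function.update_eq_self]
  rw [e1, key c]
  conv_rhs => rw [e2]
  rw [key (ω e₁)]

/-- **Leaf lemma**: if the only edges at `w` are `e₁ = {w, b}` and `e₂`, and `e₂` is closed, then
changing the state of `e₁` changes no connection between vertices other than `w`. -/
lemma conn_leaf_iff {e₁ e₂ : E} {b : V} (H : ∀ e, w ∈ ends e → e = e₁ ∨ e = e₂)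
    (hends : ends e₁ = s(w, b)) {ω : Config E} (ho : ω e₂ = false) {x y : V} (hx : x ≠ w)
    (hy : y ≠ w) (c : Bool) : Conn ends (Function.update ω e₁ c) x y ↔ Conn ends ω x y := by
  refine conn_leaf_iff_of_closed ends w hends (fun e he => ?_) hx hy c
  rcases H e he.1 with rfl | rfl
  · exact absurd rfl he.2
  · exact ho

end Leaf

section LeafZero

variable {V : Type*} {E : Type*} [Fintype E] [DecidableEq E] {R : Type*} [Field R]
  (ends : E → Sym2 V) (w : V)

/-- If every edge satisfying `P` has weight `0`, the law is supported on «every such edge is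
closed». -/
lemma prob_inter_closed_of_zero (p : E → R) (P : E → Prop) (hz : ∀ e, P e → p e = 0)
    (S : Set (Config E)) : prob p S = prob p (S ∩ {ω : Config E | ∀ e, P e → ω e = false}) := by
  unfold prob
  refine Finset.sum_congr rfl fun ω _ => ?_
  by_cases hC : ω ∈ {ω : Config E | ∀ e, P e → ω e = false}
  · by_cases hS : ω ∈ S
    · rw [Set.indicator_of_mem hS,
        Set.indicator_of_mem (show ω ∈ S ∩ {ω : Config E | ∀ e, P e → ω e = false} from ⟨hS, hC⟩)]
    · rw [Set.indicator_of_notMem hS, Set.indicator_of_notMem fun h => hS h.1]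
  · have hw : weight p ω = 0 := by
      simp only [Set.mem_setOf_eq, not_forall] at hC
      obtain ⟨e, he, hopen⟩ := hC
      have h' : ω e = true := by simpa using hopen
      rw [weight_eq_mul_edgeFactor p ω e, h', hz e he]
      simp [edgeFactor]
    simp only [Set.indicator_apply, hw]
    split_ifs <;> rfl

/-- **Leaf invariance, weight-free form**: if every edge at `w` other than `e₁` has weight `0`
and `S` is invariant under forcing `e₁` on the configurations in which those edges are closed,
then `P_{p[e₁ ↦ c]}(S) = P_p(S)` for `c ∈ {0, 1}`. -/
lemma prob_leaf_update_of_zero (p : E → R) {e₁ : E} (hz : ∀ e, w ∈ ends e ∧ e ≠ e₁ → p e = 0)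
    (c : R) (hc : c = 0 ∨ c = 1) (S : Set (Config E))
    (hS : ∀ ω : Config E, (∀ e, w ∈ ends e ∧ e ≠ e₁ → ω e = false) →
      ∀ c' : Bool, (Function.update ω e₁ c' ∈ S ↔ ω ∈ S)) :
    prob (Function.update p e₁ c) S = prob p S := by
  have hz' : ∀ e, w ∈ ends e ∧ e ≠ e₁ → Function.update p e₁ c e = 0 := by
    intro e he
    rw [Function.update_of_ne he.2]
    exact hz e he
  set C : Set (Config E) := {ω : Config E | ∀ e, w ∈ ends e ∧ e ≠ e₁ → ω e = false} with hC
  have hCinv : ∀ (ω : Config E) (c' : Bool), Function.update ω e₁ c' ∈ C ↔ ω ∈ C := by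
    intro ω c'
    simp only [hC, Set.mem_setOf_eq]
    constructor
    · intro h e he
      have := h e he
      rwa [Function.update_of_ne he.2] at this
    · intro h e he
      rw [Function.update_of_ne he.2]
      exact h e he
  have hSC : ∀ c' : Bool, {ω : Config E | Function.update ω e₁ c' ∈ S ∩ C} = S ∩ C := by
    intro c'
    ext ω
    simp only [Set.mem_setOf_eq, Set.mem_inter_iff]
    constructor
    · rintro ⟨h1, h2⟩
      have h2' := (hCinv ω c').1 h2
      exact ⟨(hS ω h2' c').1 h1, h2'⟩
    · rintro ⟨h1, h2⟩
      exact ⟨(hS ω h2 c').2 h1, (hCinv ω c').2 h2⟩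
  rw [prob_inter_closed_of_zero _ _ hz' S, prob_inter_closed_of_zero p _ hz S]
  rcases hc with rfl | rfl
  · rw [RBRootEdge.prob_update_zero_eq, hSC]
  · rw [RBRootEdge.prob_update_one_eq, hSC]

/-- **Leaf invariance of the row masses, weight-free form**: if every edge at `w` other than
`e₁ = {w, v}` has weight `0` and `w ∉ {s, t, b, o}`, forcing `e₁` does not change `P(S)` for
`S ∈ {Q, Q ∩ bL, Q ∩ oL, Q ∩ oH, Q ∩ bL ∩ oL, Q ∩ bL ∩ oH}`. -/
lemma prob_leaf_update_events (p : E → R) {e₁ : E} {v : V}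
    (hz : ∀ e, w ∈ ends e ∧ e ≠ e₁ → p e = 0) (hends : ends e₁ = s(w, v)) (s t b o : V)
    (hws : s ≠ w) (hwt : t ≠ w) (hwb : b ≠ w) (hwo : o ≠ w) (c : R) (hc : c = 0 ∨ c = 1) :
    prob (Function.update p e₁ c) (connEvent ends s t)ᶜ = prob p (connEvent ends s t)ᶜ ∧
      prob (Function.update p e₁ c) ((connEvent ends s t)ᶜ ∩ connEvent ends b s) =
        prob p ((connEvent ends s t)ᶜ ∩ connEvent ends b s) ∧
      prob (Function.update p e₁ c) ((connEvent ends s t)ᶜ ∩ connEvent ends o s) =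
        prob p ((connEvent ends s t)ᶜ ∩ connEvent ends o s) ∧
      prob (Function.update p e₁ c) ((connEvent ends s t)ᶜ ∩ connEvent ends o t) =
        prob p ((connEvent ends s t)ᶜ ∩ connEvent ends o t) ∧
      prob (Function.update p e₁ c) ((connEvent ends s t)ᶜ ∩ connEvent ends b s ∩ connEvent ends o s) =
        prob p ((connEvent ends s t)ᶜ ∩ connEvent ends b s ∩ connEvent ends o s) ∧
      prob (Function.update p e₁ c) ((connEvent ends s t)ᶜ ∩ connEvent ends b s ∩ connEvent ends o t) =
        prob p ((connEvent ends s t)ᶜ ∩ connEvent ends b s ∩ connEvent ends o t) := by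
  have hQ : ∀ ω : Config E, (∀ e, w ∈ ends e ∧ e ≠ e₁ → ω e = false) → ∀ c' : Bool,
      (Function.update ω e₁ c' ∈ (connEvent ends s t)ᶜ ↔ ω ∈ (connEvent ends s t)ᶜ) := by
    intro ω hcl c'
    simp only [Set.mem_compl_iff, mem_connEvent]
    exact not_congr (conn_leaf_iff_of_closed ends w hends hcl hws hwt c')
  have hE : ∀ (x y : V), x ≠ w → y ≠ w → ∀ ω : Config E,
      (∀ e, w ∈ ends e ∧ e ≠ e₁ → ω e = false) → ∀ c' : Bool,
      (Function.update ω e₁ c' ∈ connEvent ends x y ↔ ω ∈ connEvent ends x y) := by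
    intro x y hx hy ω hcl c'
    simp only [mem_connEvent]
    exact conn_leaf_iff_of_closed ends w hends hcl hx hy c'
  refine ⟨prob_leaf_update_of_zero ends w p hz c hc _ hQ, ?_, ?_, ?_, ?_, ?_⟩ <;>
    refine prob_leaf_update_of_zero ends w p hz c hc _ fun ω hcl c' => ?_ <;>
    simp only [Set.mem_inter_iff]
  · exact and_congr (hQ ω hcl c') (hE b s hwb hws ω hcl c')
  · exact and_congr (hQ ω hcl c') (hE o s hwo hws ω hcl c')
  · exact and_congr (hQ ω hcl c') (hE o t hwo hwt ω hcl c')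
  · exact and_congr (and_congr (hQ ω hcl c') (hE b s hwb hws ω hcl c')) (hE o s hwo hws ω hcl c')
  · exact and_congr (and_congr (hQ ω hcl c') (hE b s hwb hws ω hcl c')) (hE o t hwo hwt ω hcl c')

end LeafZero

section Affine

variable {V : Type*} {E : Type*} [Fintype E] [DecidableEq E] [Fintype V] {R : Type*} [Field R]
  [LinearOrder R] [IsStrictOrderedRing R] (ends : E → Sym2 V) (s t w : V) {e : E}

omit [Fintype E] [DecidableEq E] [Fintype V] [Field R] [LinearOrder R] [IsStrictOrderedRing R] in
/-- `{b ↔ s} = {s ↔ b}`. -/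
lemma connEvent_comm (b : V) : connEvent ends b s = connEvent ends s b := by
  ext ω
  simp only [mem_connEvent]
  exact ⟨conn_symm, conn_symm⟩

omit [Fintype V] in
/-- **Affinity of the atom term in the weight of the marker edge `e = {w, b}`**, same form. -/
lemma term_pin_same_marker {p : E → R} (hp : IsProbVec p) {b : V} (hends : ends e = s(w, b))
    (o : V) (A : Set V) :
    prob p ((connEvent ends s t)ᶜ ∩ clusterEvent ends w A ∩ connEvent ends b s) *
        prob p ((connEvent ends s t)ᶜ ∩ clusterEvent ends w A ∩ connEvent ends o s) /
      prob p ((connEvent ends s t)ᶜ ∩ clusterEvent ends w A) =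
    p e * (prob (Function.update p e 1) ((connEvent ends s t)ᶜ ∩ clusterEvent ends w A ∩
            connEvent ends b s) *
          prob (Function.update p e 1) ((connEvent ends s t)ᶜ ∩ clusterEvent ends w A ∩
            connEvent ends o s) /
        prob (Function.update p e 1) ((connEvent ends s t)ᶜ ∩ clusterEvent ends w A)) +
      (1 - p e) * (prob (Function.update p e 0) ((connEvent ends s t)ᶜ ∩ clusterEvent ends w A ∩
            connEvent ends b s) *
          prob (Function.update p e 0) ((connEvent ends s t)ᶜ ∩ clusterEvent ends w A ∩
            connEvent ends o s) /
        prob (Function.update p e 0) ((connEvent ends s t)ᶜ ∩ clusterEvent ends w A)) := by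
  by_cases hb : b ∈ A
  · by_cases hs : s ∈ A
    · by_cases ht : t ∈ A
      · rw [RBRootEdge.compl_inter_atom_of_mem_mem ends s t w hs ht]
        simp
      · rw [RBRootEdge.compl_inter_atom_of_mem_notMem ends s t w hs ht]
        exact RBRootEdge.affine_of_factor (prob_eq_pin p _ e)
          (RBRootEdge.prob_atom_inter_conn_root p ends s w hs b)
          (RBRootEdge.prob_atom_inter_conn_root _ ends s w hs b)
          (RBRootEdge.prob_atom_inter_conn_root _ ends s w hs b)
          (RBRootEdge.prob_atom_inter_conn_root p ends s w hs o)
          (RBRootEdge.prob_atom_inter_conn_root _ ends s w hs o)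
          (RBRootEdge.prob_atom_inter_conn_root _ ends s w hs o)
    · -- `b ∈ C(w)`, `s ∉ C(w)`: `{b ↔ s}` is impossible on the atom
      have h0 : ∀ q : E → R, prob q ((connEvent ends s t)ᶜ ∩ clusterEvent ends w A ∩
          connEvent ends b s) = 0 := by
        intro q
        rw [Set.inter_assoc, connEvent_comm ends s b,
          RBRootEdge.atom_inter_connEvent_of_notMem ends b w hb hs, Set.inter_empty, prob_empty]
      rw [h0, h0, h0]
      simp
  · -- `b ∉ A`: the edge is closed on the atom
    have hp0 : IsProbVec (Function.update p e 0) := hp.update e le_rfl zero_le_one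
    rw [Set.inter_right_comm _ _ (connEvent ends b s), Set.inter_right_comm _ _ (connEvent ends o s)]
    set d0 := prob (Function.update p e 0) ((connEvent ends s t)ᶜ ∩ clusterEvent ends w A) with hd0
    set a0 := prob (Function.update p e 0) ((connEvent ends s t)ᶜ ∩ connEvent ends b s ∩
      clusterEvent ends w A) with ha0
    set b0 := prob (Function.update p e 0) ((connEvent ends s t)ᶜ ∩ connEvent ends o s ∩
      clusterEvent ends w A) with hb0
    have ha0' : a0 = d0 * (a0 / d0) := by
      by_cases h : d0 = 0
      · have hle : a0 ≤ d0 := prob_mono hp0 fun ω hω => ⟨hω.1.1, hω.2⟩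
        rw [h] at hle
        rw [le_antisymm hle (prob_nonneg hp0 _), h]
        simp
      · rw [mul_div_cancel₀ _ h]
    have hb0' : b0 = d0 * (b0 / d0) := by
      by_cases h : d0 = 0
      · have hle : b0 ≤ d0 := prob_mono hp0 fun ω hω => ⟨hω.1.1, hω.2⟩
        rw [h] at hle
        rw [le_antisymm hle (prob_nonneg hp0 _), h]
        simp
      · rw [mul_div_cancel₀ _ h]
    refine RBRootEdge.affine_of_factor (c₁ := a0 / d0) (c₂ := b0 / d0) (prob_eq_pin p _ e) ?_ ha0'
      ?_ ?_ hb0' ?_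
    · rw [RBRootEdge.prob_atom_of_notMem p ends b w hends hb ((connEvent ends s t)ᶜ ∩ connEvent ends b s),
        RBRootEdge.prob_atom_of_notMem p ends b w hends hb (connEvent ends s t)ᶜ, ← ha0, ← hd0,
        mul_assoc, ← ha0']
    · rw [RBRootEdge.prob_update_one_atom_of_notMem p ends b w hends hb
        ((connEvent ends s t)ᶜ ∩ connEvent ends b s),
        RBRootEdge.prob_update_one_atom_of_notMem p ends b w hends hb (connEvent ends s t)ᶜ, zero_mul]
    · rw [RBRootEdge.prob_atom_of_notMem p ends b w hends hb ((connEvent ends s t)ᶜ ∩ connEvent ends o s),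
        RBRootEdge.prob_atom_of_notMem p ends b w hends hb (connEvent ends s t)ᶜ, ← hb0, ← hd0,
        mul_assoc, ← hb0']
    · rw [RBRootEdge.prob_update_one_atom_of_notMem p ends b w hends hb
        ((connEvent ends s t)ᶜ ∩ connEvent ends o s),
        RBRootEdge.prob_update_one_atom_of_notMem p ends b w hends hb (connEvent ends s t)ᶜ, zero_mul]

/-- **Affinity of the Rao–Blackwell sum in the weight of the marker edge `e = {w, b}`**, same
form. -/
theorem rbSum_pin_same_marker {p : E → R} (hp : IsProbVec p) {b : V} (hends : ends e = s(w, b))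
    (o : V) :
    RBRoot.rbSum p ends s t w (connEvent ends b s) (connEvent ends o s) =
      p e * RBRoot.rbSum (Function.update p e 1) ends s t w (connEvent ends b s) (connEvent ends o s) +
        (1 - p e) * RBRoot.rbSum (Function.update p e 0) ends s t w (connEvent ends b s)
          (connEvent ends o s) := by
  unfold RBRoot.rbSum
  rw [Finset.mul_sum, Finset.mul_sum, ← Finset.sum_add_distrib]
  exact Finset.sum_congr rfl fun A _ => term_pin_same_marker ends s t w hp hends o A

/-- Under `p[e ↦ 1]` with `e = {w, b}` the Rao–Blackwell sum at `w` is the sum at the marker `b`,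
which collapses: `rbSum = P(Q ∩ bL ∩ oL)`. -/
theorem rbSum_update_one_marker (p : E → R) (hp : IsProbVec p) {b : V} (hends : ends e = s(w, b))
    (o : V) :
    RBRoot.rbSum (Function.update p e 1) ends s t w (connEvent ends b s) (connEvent ends o s) =
      prob (Function.update p e 1) ((connEvent ends s t)ᶜ ∩ connEvent ends b s ∩ connEvent ends o s) := by
  have hp1 : IsProbVec (Function.update p e 1) := hp.update e zero_le_one le_rfl
  rw [show RBRoot.rbSum (Function.update p e 1) ends s t w (connEvent ends b s) (connEvent ends o s) =
      RBRoot.rbSum (Function.update p e 1) ends s t b (connEvent ends b s) (connEvent ends o s) by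
    unfold RBRoot.rbSum
    refine Finset.sum_congr rfl fun A _ => ?_
    rw [Set.inter_right_comm _ (clusterEvent ends w A), Set.inter_right_comm _ (clusterEvent ends w A),
      RBRootEdge.prob_update_one_atom_eq p ends b w hends _ A,
      RBRootEdge.prob_update_one_atom_eq p ends b w hends _ A,
      RBRootEdge.prob_update_one_atom_eq p ends b w hends _ A,
      ← Set.inter_right_comm _ (clusterEvent ends b A), ← Set.inter_right_comm _ (clusterEvent ends b A)]]
  rw [RBRoot.connEvent_eq_clusterInEvent_left ends b s, RBRoot.rbSum_of_clusterInEvent ends hp1,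
    ← RBRoot.connEvent_eq_clusterInEvent_left ends b s]

end Affine

section Algebra

variable {R : Type*} [Field R] [LinearOrder R] [IsStrictOrderedRing R]

/-- **The variance-dominated mixture inequality**: for `x ∈ [0,1]`, `0 ≤ M ≤ Z₁`, `0 ≤ A ≤ Z`,
`0 ≤ C ≤ Z`,
`(xM + (1−x)A)(xM + (1−x)C)/(xZ₁ + (1−x)Z) ≤ xM + (1−x)·(AC/Z)`. -/
lemma mix_var {x M Z₁ A C Z : R} (hx0 : 0 ≤ x) (hx1 : x ≤ 1) (hM0 : 0 ≤ M) (hMZ : M ≤ Z₁)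
    (hA0 : 0 ≤ A) (hAZ : A ≤ Z) (hC0 : 0 ≤ C) (hCZ : C ≤ Z) :
    (x * M + (1 - x) * A) * (x * M + (1 - x) * C) / (x * Z₁ + (1 - x) * Z) ≤
      x * M + (1 - x) * (A * C / Z) := by
  have hx1' : 0 ≤ 1 - x := sub_nonneg.2 hx1
  rcases eq_or_lt_of_le (hM0.trans hMZ) with hZ1 | hZ1
  · -- `Z₁ = 0`: `M = 0`
    have hM : M = 0 := le_antisymm (hZ1 ▸ hMZ) hM0
    rw [← hZ1, hM]
    simp only [mul_zero, zero_add]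
    rcases eq_or_lt_of_le hx1' with hx | hx
    · rw [← hx]; simp
    · rcases eq_or_lt_of_le (hA0.trans hAZ) with hZ | hZ
      · rw [← hZ, mul_zero, div_zero, div_zero, mul_zero]
      · rw [show (1 - x) * A * ((1 - x) * C) / ((1 - x) * Z) = (1 - x) * (A * C / Z) by field_simp]
  rcases eq_or_lt_of_le (hA0.trans hAZ) with hZ | hZ
  · -- `Z = 0`: `A = C = 0`
    have hA : A = 0 := le_antisymm (hZ ▸ hAZ) hA0
    have hC : C = 0 := le_antisymm (hZ ▸ hCZ) hC0
    rw [← hZ, hA, hC]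
    simp only [mul_zero, add_zero, div_zero]
    rcases eq_or_lt_of_le hx0 with hx | hx
    · rw [← hx]; simp
    · rw [show x * M * (x * M) / (x * Z₁) = x * (M * M / Z₁) by field_simp]
      have : M * M / Z₁ ≤ M := by
        rw [div_le_iff₀ hZ1]
        exact mul_le_mul_of_nonneg_left hMZ hM0
      exact mul_le_mul_of_nonneg_left this hx0
  · have hZZ : 0 < x * Z₁ + (1 - x) * Z := by
      rcases eq_or_lt_of_le hx0 with hx | hx
      · rw [← hx]; simpa using hZ
      · exact add_pos_of_pos_of_nonneg (mul_pos hx hZ1) (mul_nonneg hx1' hZ.le)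
    rw [div_le_iff₀ hZZ]
    have h1 : 0 ≤ x * x * M * Z * (Z₁ - M) :=
      mul_nonneg (mul_nonneg (mul_nonneg (mul_nonneg hx0 hx0) hM0) hZ.le) (sub_nonneg.2 hMZ)
    have h2 : 0 ≤ x * (1 - x) * (M * ((Z - A) * (Z - C)) + (Z₁ - M) * (A * C)) :=
      mul_nonneg (mul_nonneg hx0 hx1') (add_nonneg
        (mul_nonneg hM0 (mul_nonneg (sub_nonneg.2 hAZ) (sub_nonneg.2 hCZ)))
        (mul_nonneg (sub_nonneg.2 hMZ) (mul_nonneg hA0 hC0)))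
    have key : (x * M + (1 - x) * (A * C / Z)) * (x * Z₁ + (1 - x) * Z) -
        (x * M + (1 - x) * A) * (x * M + (1 - x) * C) =
        (x * x * M * Z * (Z₁ - M) + x * (1 - x) * (M * ((Z - A) * (Z - C)) + (Z₁ - M) * (A * C))) / Z := by
      field_simp
      ring
    have : 0 ≤ (x * M + (1 - x) * (A * C / Z)) * (x * Z₁ + (1 - x) * Z) -
        (x * M + (1 - x) * A) * (x * M + (1 - x) * C) := by
      rw [key]
      exact div_nonneg (add_nonneg h1 h2) hZ.le
    linarith

end Algebra

end RBTwoMarkers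

end Summit.Ventures.PercRepro2
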